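import Literature.Topology.FourManifolds.MMSWRasmussenFacts
import Literature.Topology.FourManifolds.MMSWRasmussenGeneralPosition
import Summits.SmoothPoincare4.SmoothPoincare4.Theses.DottedCircleRasmussen
import Summits.SmoothPoincare4.SmoothPoincare4.Theorems.DottedCircleRasmussenDcrGfgmw

/-!
# Helper `helper_friendsCarrier_exterior` of stub `stub_friendsCarrier` (line `mk_friends`, crux `DcrGap`)
(item stmt-SmoothPoincare4-16128, route route-SmoothPoincare4-DottedCircleRasmussen)

The carrier `X = (D_k ∪ collar ∪ h²_{K₀}) ∪_Y (W₀ ∖ νΔ₁)` of the friends lemma (stub A of the line,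
the `k ≥ 1` analogue of the tree's `Knot.ManolescuPiccirillo2023_lemma33_sphere_construction`) is glued
from two open pieces; the EXTERIOR piece is the model disc exterior
`E = ℝ⁴ ∖ (D_k ∪ Δ₁)`, `Δ₁ = f₁(𝔻²)` a model slice disc (`MMSW.IsModelSliceDisc k K₁ f₁`), compactified
at infinity by ONE point `q`.  This file proves the point-set facts that make these two objects
well-formed `TopologicalSpace.Opens (ℝ⁴)` (hence open submanifolds of `ℝ⁴`, no `S⁴` needed):

* `isClosed_modelHandlebody`, `isCompact_modelHandlebody` — the model dotted handlebody
  `D_k = {guard ∧ G_k ≤ 1}` is compact (closed: `G_k` is continuous on the closed guard set; bounded: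
  the landed `DcrGfgmw.norm_le_of_mem_modelHandlebody`);
* `isCompact_modelHandlebody_union_disc` — `D_k ∪ f₁(𝔻²)` is compact;
* `isOpen_modelDiscExterior` — `E = {x | x ∉ D_k ∧ x ∉ f₁(𝔻²)}` is open (the set of the stub's clause
  `(E : Set ℝ⁴) = {x | x ∉ modelHandlebody k ∧ x ∉ f₁ '' 𝔻²}`);
* `isOpen_invertedModelDiscExterior` — the INVERTED exterior with the point at infinity filled in,
  `E^ = {0} ∪ {y ≠ 0 | y/‖y‖² ∈ E}`, is open in `ℝ⁴`: the inversion `y ↦ y/‖y‖²` in the unit sphere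
  carries `E` onto `E^ ∖ {0}` and a punctured ball `0 < ‖y‖ < 1/(R+1)` (`R` a bound for the compact
  `D_k ∪ Δ₁`) into `E`, so `0 ∈ E^` is an interior point — this is the chart at `q = ∞` of the exterior
  piece (Kosinski, *Differential Manifolds* (1993), VI §5; the inversion as in the tree's
  `PalaisComplementBallInversion.lean`).

`helper_friendsCarrier_exterior` packages the three statements in the quantifier shape of the stub.
No definitions, no named facts, no `sorry`.
-/

-- the prescribed namespace `Summit.<P>.<Sub>.…` duplicates `SmoothPoincare4` (P = Sub)
set_option linter.dupNamespace false
set_option linter.style.longLine false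

noncomputable section

open scoped Manifold ContDiff Topology
open Function Set Metric
open Literature.Topology.FourManifolds Literature.Topology.FourManifolds.MMSW

namespace Summit.SmoothPoincare4.SmoothPoincare4.Theorems.DcrGap.MkFriends

/-! ## The model handlebody is compact -/

/-- **`D_k` is closed**: the guard set `{∀ j, 1 ≤ |z - c_j|²}` is closed and `G_k` is continuous on it.
[folklore] -/
theorem isClosed_modelHandlebody (k : ℕ) : IsClosed (modelHandlebody k) := by
  have : modelHandlebody k =
      {x : EuclideanSpace ℝ (Fin 4) | ∀ j : Fin k, 1 ≤ holeTerm k j x} ∩ levelFun k ⁻¹' Iic 1 := rfl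
  rw [this]
  exact (continuousOn_levelFun one_pos).preimage_isClosed_of_isClosed (isClosed_guard 1) isClosed_Iic

/-- **`D_k` is compact** (closed and bounded in `ℝ⁴`). [folklore] -/
theorem isCompact_modelHandlebody (k : ℕ) : IsCompact (modelHandlebody k) :=
  Metric.isCompact_of_isClosed_isBounded (isClosed_modelHandlebody k)
    ((isBounded_closedBall (x := (0 : EuclideanSpace ℝ (Fin 4)))
      (r := 40 * ((k : ℝ) + 1) + 1)).subset fun _ hx =>
        mem_closedBall_zero_iff.2 (DcrGfgmw.norm_le_of_mem_modelHandlebody hx))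

/-! ## The model disc exterior and its inversion -/

/-- **`D_k ∪ Δ₁` is compact** for a model slice disc `Δ₁ = f₁(𝔻²)` (continuous image of the compact
closed disc). [folklore] -/
theorem isCompact_modelHandlebody_union_disc {k : ℕ}
    {K₁ : (Metric.sphere (0 : EuclideanSpace ℝ (Fin 2)) 1) → EuclideanSpace ℝ (Fin 4)}
    {f₁ : EuclideanSpace ℝ (Fin 2) → EuclideanSpace ℝ (Fin 4)} (h : IsModelSliceDisc k K₁ f₁) :
    IsCompact (modelHandlebody k ∪ f₁ '' closedBall (0 : EuclideanSpace ℝ (Fin 2)) 1) :=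
  (isCompact_modelHandlebody k).union ((isCompact_closedBall _ _).image h.1.continuous)

/-- **The model disc exterior `E = ℝ⁴ ∖ (D_k ∪ Δ₁)` is open.** [folklore] -/
theorem isOpen_modelDiscExterior {k : ℕ}
    {K₁ : (Metric.sphere (0 : EuclideanSpace ℝ (Fin 2)) 1) → EuclideanSpace ℝ (Fin 4)}
    {f₁ : EuclideanSpace ℝ (Fin 2) → EuclideanSpace ℝ (Fin 4)} (h : IsModelSliceDisc k K₁ f₁) :
    IsOpen {x : EuclideanSpace ℝ (Fin 4) | x ∉ modelHandlebody k ∧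
      x ∉ f₁ '' closedBall (0 : EuclideanSpace ℝ (Fin 2)) 1} := by
  have : {x : EuclideanSpace ℝ (Fin 4) | x ∉ modelHandlebody k ∧
      x ∉ f₁ '' closedBall (0 : EuclideanSpace ℝ (Fin 2)) 1} =
      (modelHandlebody k ∪ f₁ '' closedBall (0 : EuclideanSpace ℝ (Fin 2)) 1)ᶜ := by
    ext x
    simp only [mem_setOf_eq, mem_compl_iff, mem_union, not_or]
  rw [this]
  exact (isCompact_modelHandlebody_union_disc h).isClosed.isOpen_compl

/-- The inversion `y ↦ y/‖y‖²` has norm `1/‖y‖`. [folklore] -/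
theorem norm_inv_normSq_smul (y : EuclideanSpace ℝ (Fin 4)) : ‖(‖y‖ ^ 2)⁻¹ • y‖ = ‖y‖⁻¹ := by
  rcases eq_or_ne y 0 with rfl | hy
  · simp
  · have hn : ‖y‖ ≠ 0 := norm_ne_zero_iff.2 hy
    rw [norm_smul, norm_inv, norm_pow, norm_norm]
    field_simp

/-- **The inverted model disc exterior, with the point at infinity, is open.**  For a model slice disc
`Δ₁ = f₁(𝔻²)` the set `E^ = {0} ∪ {y ≠ 0 | y/‖y‖² ∉ D_k ∧ y/‖y‖² ∉ Δ₁}` — the image of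
`E = ℝ⁴ ∖ (D_k ∪ Δ₁)` under the inversion in the unit sphere together with `0 = ∞⁻¹` — is an open
subset of `ℝ⁴`: off `0` it is the preimage of the open `E` under the continuous inversion, and it
contains the ball of radius `1/(R+1)` about `0`, `R ≥ 0` a bound of the compact `D_k ∪ Δ₁`.  This is the
chart at infinity of the exterior piece `W₀ ∖ Δ₁`, `W₀ = (ℝ⁴ ∖ D_k°) ∪ {∞}`.
[cite: Kosinski1993, Ch. VI §5] -/
theorem isOpen_invertedModelDiscExterior {k : ℕ}
    {K₁ : (Metric.sphere (0 : EuclideanSpace ℝ (Fin 2)) 1) → EuclideanSpace ℝ (Fin 4)}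
    {f₁ : EuclideanSpace ℝ (Fin 2) → EuclideanSpace ℝ (Fin 4)} (h : IsModelSliceDisc k K₁ f₁) :
    IsOpen ({0} ∪ {y : EuclideanSpace ℝ (Fin 4) | y ≠ 0 ∧
      (‖y‖ ^ 2)⁻¹ • y ∉ modelHandlebody k ∧
      (‖y‖ ^ 2)⁻¹ • y ∉ f₁ '' closedBall (0 : EuclideanSpace ℝ (Fin 2)) 1}) := by
  set C : Set (EuclideanSpace ℝ (Fin 4)) :=
    modelHandlebody k ∪ f₁ '' closedBall (0 : EuclideanSpace ℝ (Fin 2)) 1 with hC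
  have hCc : IsCompact C := isCompact_modelHandlebody_union_disc h
  obtain ⟨R, hR⟩ := hCc.isBounded.exists_norm_le
  set S : Set (EuclideanSpace ℝ (Fin 4)) := {y | y ≠ 0 ∧ (‖y‖ ^ 2)⁻¹ • y ∉ C} with hS
  have hSeq : {y : EuclideanSpace ℝ (Fin 4) | y ≠ 0 ∧ (‖y‖ ^ 2)⁻¹ • y ∉ modelHandlebody k ∧
      (‖y‖ ^ 2)⁻¹ • y ∉ f₁ '' closedBall (0 : EuclideanSpace ℝ (Fin 2)) 1} = S := by
    ext y
    simp only [hS, hC, mem_setOf_eq, mem_union, not_or]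
  rw [hSeq]
  -- `S` is open: the inversion is continuous off `0` and `C` is closed
  have hSo : IsOpen S := by
    have hcont : ContinuousOn (fun y : EuclideanSpace ℝ (Fin 4) => (‖y‖ ^ 2)⁻¹ • y) {y | y ≠ 0} := by
      have h1 : ContinuousOn (fun y : EuclideanSpace ℝ (Fin 4) => (‖y‖ ^ 2)⁻¹) {y | y ≠ 0} :=
        ((continuous_norm.pow 2).continuousOn).inv₀ fun y hy => pow_ne_zero 2 (norm_ne_zero_iff.2 hy)
      exact h1.smul continuousOn_id
    have := hcont.isOpen_inter_preimage isOpen_ne hCc.isClosed.isOpen_compl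
    convert this using 1
    ext y
    simp only [hS, mem_setOf_eq, mem_inter_iff, mem_preimage, mem_compl_iff]
  -- a punctured ball about `0` inverts into the exterior of the bounded `C`
  have hpos : 0 < |R| + 1 := by positivity
  have hball : ball (0 : EuclideanSpace ℝ (Fin 4)) (1 / (|R| + 1)) ⊆ {0} ∪ S := by
    intro y hy
    rcases eq_or_ne y 0 with rfl | hy0
    · exact Or.inl rfl
    · refine Or.inr ⟨hy0, fun hyC => ?_⟩
      have h1 : ‖(‖y‖ ^ 2)⁻¹ • y‖ ≤ R := hR _ hyC
      rw [norm_inv_normSq_smul] at h1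
      rw [mem_ball_zero_iff] at hy
      have hny : 0 < ‖y‖ := norm_pos_iff.2 hy0
      have h2 : |R| + 1 < ‖y‖⁻¹ := by
        rw [lt_inv_comm₀ hpos hny]
        simpa [one_div] using hy
      linarith [le_abs_self R]
  have hunion : ({0} : Set (EuclideanSpace ℝ (Fin 4))) ∪ S =
      ball (0 : EuclideanSpace ℝ (Fin 4)) (1 / (|R| + 1)) ∪ S := by
    refine Subset.antisymm ?_ (union_subset hball subset_union_right)
    rintro y (hy | hy)
    · left
      rw [mem_singleton_iff.1 hy]
      exact mem_ball_self (by positivity)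
    · exact Or.inr hy
  rw [hunion]
  exact isOpen_ball.union hSo

/-- **Helper `helper_friendsCarrier_exterior`** (registered on the crux item; point-set part of the
exterior clause of stub `stub_friendsCarrier`).  For every `k` and every model slice disc
`Δ₁ = f₁(𝔻²)` of a model knot `K₁ ⊂ ∂D_k` (`MMSW.IsModelSliceDisc k K₁ f₁`): the core `D_k ∪ Δ₁` is
compact, the model disc exterior `E = {x | x ∉ D_k ∧ x ∉ Δ₁}` is open (so that the stub's
`E : TopologicalSpace.Opens ℝ⁴` with `(E : Set ℝ⁴) = {x | x ∉ modelHandlebody k ∧ x ∉ f₁ '' 𝔻²}` exists),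
and the inverted exterior with the point at infinity `{0} ∪ {y ≠ 0 | y/‖y‖² ∈ E}` is open (the chart
at `q = ∞` of the exterior piece of the carrier). [cite: Kosinski1993, Ch. VI §5] -/
theorem helper_friendsCarrier_exterior : ∀ (k : ℕ) (K₁ : (Metric.sphere (0 : EuclideanSpace ℝ (Fin 2)) 1) → EuclideanSpace ℝ (Fin 4)) (f₁ : EuclideanSpace ℝ (Fin 2) → EuclideanSpace ℝ (Fin 4)), Literature.Topology.FourManifolds.MMSW.IsModelSliceDisc k K₁ f₁ → IsCompact (Literature.Topology.FourManifolds.MMSW.modelHandlebody k ∪ f₁ '' Metric.closedBall (0 : EuclideanSpace ℝ (Fin 2)) 1) ∧ IsOpen {x : EuclideanSpace ℝ (Fin 4) | x ∉ Literature.Topology.FourManifolds.MMSW.modelHandlebody k ∧ x ∉ f₁ '' Metric.closedBall (0 : EuclideanSpace ℝ (Fin 2)) 1} ∧ IsOpen ({0} ∪ {y : EuclideanSpace ℝ (Fin 4) | y ≠ 0 ∧ (‖y‖ ^ 2)⁻¹ • y ∉ Literature.Topology.FourManifolds.MMSW.modelHandlebody k ∧ (‖y‖ ^ 2)⁻¹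 • y ∉ f₁ '' Metric.closedBall (0 : EuclideanSpace ℝ (Fin 2)) 1}) :=
  fun _ _ _ h => ⟨isCompact_modelHandlebody_union_disc h, isOpen_modelDiscExterior h,
    isOpen_invertedModelDiscExterior h⟩

end Summit.SmoothPoincare4.SmoothPoincare4.Theorems.DcrGap.MkFriends

end
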